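import Literature.MathematicalPhysics.KineticTheory.HardSphereDLRConsistency
import HarnessLib

/-!
# Decay of covariances under the free finite-volume hard-sphere distribution

(topic MathematicalPhysics/KineticTheory; no new definitions, no new named facts; the general-dimension port — `EuclideanSpace ℝ ι`, namespace `HardSphereDLR`, `ℝ³` in the comments standing for `ℝ^ι` — of `HardSphereFreeMeasureCovariance.lean`, seventh file of the general-`d` port needed for `HardSphereGibbsLowDensityUniqueness`.)

For the free finite-volume Gibbs distribution `P = γ_{B(0,R')}(· | ∅)` (`hsLocalSpec σ ν (ball 0 R') ∅`)
of the hard-sphere gas with a low one-particle intensity `ν` (mass `≤ κ` on every ball window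
`B°_σ(·) × ℝ³`, `2κ < 1`), an event `A` depending only on the configuration in `B(0,k) × ℝ³` and
an event `E` depending only on the configuration outside `B(0,R) × ℝ³`, `k + (d+2)σ ≤ R ≤ R'`, are
almost uncorrelated:

  `|P(A ∩ E) - P(A) P(E)| ≤ 2 · (2 ν(B(0,k) × ℝ³) e^{ν(B(0,k) × ℝ³)} (2κ)^d) · P(E)`.

This is the covariance form of the uniqueness mechanism of Michelen–Perkins (2021, Thm 25 and §5:
the influence of the boundary condition on a local event decays geometrically in the number `d`
of shells of width `σ` separating them), obtained here from three tree results: the DLR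
consistency of the free distribution (`lintegral_hsLocalSpec_hsLocalSpec_empty`, Georgii 2011
Def. 1.23), the locality of the specification in events of the outside
(`hsLocalSpec_inter_preimage_restrict_compl`, proved here), and the boundary-influence estimate
`abs_hsLocalSpec_toReal_sub_le`: conditioning `P` on `E` produces another mixture of the kernels
`γ_{B(0,R)}(· | ζ)` over hard-core `ζ`, and any two such mixtures give `A` probabilities within
twice the boundary-influence bound of each other.

The special case used downstream (`abs_measureReal_vacant_inter_vacant_sub_le`): the vacancy
events `V = {N(B°_σ(0) × ℝ³) = 0}` and `E_x = {N(B°_σ(x) × ℝ³) = 0}` of two balls at distance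
`‖x‖ ≥ (d+4)σ` have covariance at most `2 · 2ν(B°_σ(0) × ℝ³) e^{ν(B°_σ(0) × ℝ³)} (2κ)^d` under every
`γ_{B(0,R')}(· | ∅)` with `‖x‖ - σ ≤ R'` — the input of the activity-derivative bound for the free
hard-sphere probabilities (Ruelle 1969, §4.2, analyticity of the low-activity correlation
functions, in the DLR form needed by `HardSphereGibbsLowDensityUniqueness`).

## References

* M. Michelen, W. Perkins, *Potential-weighted connective constants and uniqueness of Gibbs
  measures*, arXiv:2109.01094, Thm 25 and §5. [MichelenPerkins2021]
* H.-O. Georgii, *Gibbs Measures and Phase Transitions*, 2nd ed., de Gruyter 2011, Def. 1.23,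
  (1.24) (consistency; conditional probabilities of a Gibbs measure). [Georgii2011]
* D. Ruelle, *Statistical Mechanics: Rigorous Results*, Benjamin 1969, §4.2. [Ruelle1969]
-/

noncomputable section

open MeasureTheory ProbabilityTheory Set Filter
open scoped ENNReal NNReal

namespace Literature.MathematicalPhysics.KineticTheory

namespace HardSphereDLR

open Literature.Analysis.FluidPDE (IsHardCore isHardCore_empty)
open Literature.Analysis.FunctionSpaces
open Literature.MathematicalPhysics.StatisticalMechanics (window mem_window measurableSet_window window_mono)

variable {ι : Type*} [Fintype ι] (i₀ : ι)


/-! ### Locality of the specification in events of the outside -/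

section Locality

variable (ν : Measure (EuclideanSpace ℝ ι × EuclideanSpace ℝ ι)) {σ : ℝ}

/-- **Locality of the specification in outside events** (Georgii's properness,
`γ_Λ(A ∩ B | η) = 1_B(η) γ_Λ(A | η)` for `B` in the outside σ-algebra): for an event
`E = {ζ | ζ|_{(Λ × ℝ³)ᶜ} ∈ E'}` of the configuration outside the window,
`γ_Λ(η)(A ∩ E) = 1_E(η) γ_Λ(η)(A)`. [cite: Georgii2011, Def. 1.23 and (1.24)] -/
theorem hsLocalSpec_inter_preimage_restrict_compl (σ : ℝ) {Λ : Set (EuclideanSpace ℝ ι)} (hΛ : MeasurableSet Λ)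
    (η : PointConfig (EuclideanSpace ℝ ι × EuclideanSpace ℝ ι)) {A E' : Set (PointConfig (EuclideanSpace ℝ ι × EuclideanSpace ℝ ι))} (hA : MeasurableSet A)
    (hE' : MeasurableSet E') :
    hsLocalSpec σ ν Λ η (A ∩ PointConfig.restrict (window Λ)ᶜ ⁻¹' E') =
      (PointConfig.restrict (window Λ)ᶜ ⁻¹' E').indicator 1 η * hsLocalSpec σ ν Λ η A := by
  have hW : MeasurableSet (window Λ) := measurableSet_window hΛ
  have hE : MeasurableSet (PointConfig.restrict (window Λ)ᶜ ⁻¹' E' : Set (PointConfig (EuclideanSpace ℝ ι × EuclideanSpace ℝ ι))) :=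
    hE'.preimage (PointConfig.measurable_restrict hW.compl)
  by_cases hη : η ∈ PointConfig.restrict (window Λ)ᶜ ⁻¹' E'
  · rw [indicator_of_mem hη, Pi.one_apply, one_mul, hsLocalSpec_apply_eq σ ν hΛ η (hA.inter hE),
      hsLocalSpec_apply_eq σ ν hΛ η hA]
    congr 2
    ext ξ
    have hξ : glue Λ η ξ ∈ PointConfig.restrict (window Λ)ᶜ ⁻¹' E' := by
      rw [mem_preimage, restrict_compl_glue]; exact hη
    simp only [mem_preimage, mem_inter_iff]
    exact ⟨fun h => ⟨h.1.1, h.2⟩, fun h => ⟨⟨h.1, hξ⟩, h.2⟩⟩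
  · rw [indicator_of_notMem hη, zero_mul, hsLocalSpec_apply_eq σ ν hΛ η (hA.inter hE)]
    have hempty : glue Λ η ⁻¹' (A ∩ PointConfig.restrict (window Λ)ᶜ ⁻¹' E' ∩ hardCoreSet σ) = ∅ := by
      refine eq_empty_of_forall_notMem fun ξ hξ => hη ?_
      have h2 : glue Λ η ξ ∈ PointConfig.restrict (window Λ)ᶜ ⁻¹' E' := hξ.1.2
      rwa [mem_preimage, restrict_compl_glue] at h2
    rw [hempty, measure_empty, mul_zero]

end Locality

/-! ### Mixtures of the kernels and the covariance bound -/

section Covariance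

variable (ν : Measure (EuclideanSpace ℝ ι × EuclideanSpace ℝ ι)) [IsLocallyFiniteMeasure ν] {σ : ℝ}

/-- **Any hard-core mixture of the kernels `γ_{B(0,R)}(· | η)` is pinned by the free value on local
events** (the tree's `abs_measureReal_sub_hsLocalSpec_empty_le_of_mixture` with a real inner radius
`k` and any outer radius `R ≥ k + (d+2)σ`): if `ρ` is a probability measure carried by hard-core
configurations and `∫ γ_{B(0,R)}(η)(A) dρ(η) = ρ(A)` for a local event `A` over `B(0,k)`, then
`|ρ(A) - γ_{B(0,R)}(∅)(A)| ≤ 2 ν(B(0,k) × ℝ³) e^{ν(B(0,k) × ℝ³)} (2κ)^d`.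
[cite: MichelenPerkins2021, §5, proof of Thm 25] -/
theorem abs_measureReal_sub_hsLocalSpec_empty_le_of_mixture' (hσ : 0 < σ) (h0 : ∀ x, ν {x} = 0)
    (hm : ∀ t : ℝ, ν {y : EuclideanSpace ℝ ι × EuclideanSpace ℝ ι | y.1 i₀ = t} = 0) {κ : ℝ} (hκ0 : 0 ≤ κ)
    (hκ : ∀ a : (EuclideanSpace ℝ ι), ν (window (Metric.ball a σ)) ≤ ENNReal.ofReal κ)
    {k R : ℝ} {d : ℕ} (hR : k + (d + 2) * σ ≤ R)
    (hfin : ν (window (Metric.ball (0 : (EuclideanSpace ℝ ι)) R)) ≠ ∞)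
    {ρ : Measure (PointConfig (EuclideanSpace ℝ ι × EuclideanSpace ℝ ι))} [IsProbabilityMeasure ρ] (hρ : ∀ᵐ η ∂ρ, IsHardCore σ η)
    {A' : Set (PointConfig (EuclideanSpace ℝ ι × EuclideanSpace ℝ ι))} (hA' : MeasurableSet A')
    (hmix : ∫⁻ η, hsLocalSpec σ ν (Metric.ball 0 R) η
      (PointConfig.restrict (window (Metric.ball (0 : (EuclideanSpace ℝ ι)) k)) ⁻¹' A') ∂ρ =
      ρ (PointConfig.restrict (window (Metric.ball (0 : (EuclideanSpace ℝ ι)) k)) ⁻¹' A')) :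
    |ρ.real (PointConfig.restrict (window (Metric.ball (0 : (EuclideanSpace ℝ ι)) k)) ⁻¹' A') -
      (hsLocalSpec σ ν (Metric.ball 0 R) ∅
        (PointConfig.restrict (window (Metric.ball (0 : (EuclideanSpace ℝ ι)) k)) ⁻¹' A')).toReal| ≤
      2 * ν.real (window (Metric.ball (0 : (EuclideanSpace ℝ ι)) k)) *
        Real.exp (ν.real (window (Metric.ball (0 : (EuclideanSpace ℝ ι)) k))) * (2 * κ) ^ d := by
  set A : Set (PointConfig (EuclideanSpace ℝ ι × EuclideanSpace ℝ ι)) := PointConfig.restrict (window (Metric.ball (0 : (EuclideanSpace ℝ ι)) k)) ⁻¹' A'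
    with hA
  set ε : ℝ := 2 * ν.real (window (Metric.ball (0 : (EuclideanSpace ℝ ι)) k)) *
    Real.exp (ν.real (window (Metric.ball (0 : (EuclideanSpace ℝ ι)) k))) * (2 * κ) ^ d with hε
  set c : ℝ := (hsLocalSpec σ ν (Metric.ball 0 R) ∅ A).toReal with hc
  have hε0 : 0 ≤ ε := by positivity
  have hc0 : 0 ≤ c := ENNReal.toReal_nonneg
  -- a.s. the boundary condition is hard core, hence within `ε` of the free value
  have hbound : ∀ᵐ η ∂ρ, |(hsLocalSpec σ ν (Metric.ball 0 R) η A).toReal - c| ≤ ε := by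
    filter_upwards [hρ] with η hη
    exact abs_hsLocalSpec_toReal_sub_le i₀ ν hσ h0 hm hκ0 hκ hR hfin
      (isHardCore_restrict hη _) (isHardCore_restrict (isHardCore_empty σ) _) hA'
  have hfinγ : ∀ η, hsLocalSpec σ ν (Metric.ball 0 R) η A ≠ ∞ := fun η =>
    ne_top_of_le_ne_top ENNReal.one_ne_top (hsLocalSpec_apply_le_one σ ν _ η A)
  -- upper bound
  have hup : ρ A ≤ ENNReal.ofReal (c + ε) := by
    rw [← hmix, ← mul_one (ENNReal.ofReal (c + ε)), ← measure_univ (μ := ρ), ← lintegral_const]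
    refine lintegral_mono_ae (hbound.mono fun η hη => ?_)
    rw [← ENNReal.ofReal_toReal (hfinγ η)]
    exact ENNReal.ofReal_le_ofReal (by linarith [(abs_sub_le_iff.1 hη).1])
  -- lower bound
  have hlow : ENNReal.ofReal (c - ε) ≤ ρ A := by
    rw [← hmix, ← mul_one (ENNReal.ofReal (c - ε)), ← measure_univ (μ := ρ), ← lintegral_const]
    refine lintegral_mono_ae (hbound.mono fun η hη => ?_)
    rw [← ENNReal.ofReal_toReal (hfinγ η)]
    exact ENNReal.ofReal_le_ofReal (by linarith [(abs_sub_le_iff.1 hη).2])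
  rw [abs_sub_le_iff]
  constructor
  · have h1 : ρ.real A ≤ c + ε := by
      rw [measureReal_def, ← ENNReal.toReal_ofReal (by linarith : 0 ≤ c + ε)]
      exact ENNReal.toReal_mono ENNReal.ofReal_ne_top hup
    linarith
  · have h2 : c - ε ≤ ρ.real A := by
      rw [measureReal_def]
      calc c - ε ≤ max (c - ε) 0 := le_max_left _ _
        _ = (ENNReal.ofReal (c - ε)).toReal := ENNReal.toReal_ofReal'.symm
        _ ≤ (ρ A).toReal := ENNReal.toReal_mono (measure_ne_top ρ A) hlow
    linarith

/-- **Conditioning the free distribution on an outside event gives a mixture of the kernels**: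
for `P = γ_{Λ'}(· | ∅)`, `Λ = B(0,R) ⊆ Λ'`, a measurable `A` and an outside event
`E = {ζ | ζ|_{(Λ × ℝ³)ᶜ} ∈ E'}`, `∫ 1_E(ζ) γ_Λ(ζ)(A) dP(ζ) = P(A ∩ E)` (consistency of the free
distribution and locality of the kernel). [cite: Georgii2011, Def. 1.23 and (1.24)] -/
theorem lintegral_indicator_mul_hsLocalSpec_eq (h0 : ∀ x, ν {x} = 0) {Λ Λ' : Set (EuclideanSpace ℝ ι)}
    (hΛ : MeasurableSet Λ) (hΛ' : MeasurableSet Λ') (hΛΛ' : Λ ⊆ Λ')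
    {A E' : Set (PointConfig (EuclideanSpace ℝ ι × EuclideanSpace ℝ ι))} (hA : MeasurableSet A) (hE' : MeasurableSet E') :
    ∫⁻ ζ, (PointConfig.restrict (window Λ)ᶜ ⁻¹' E').indicator 1 ζ * hsLocalSpec σ ν Λ ζ A
        ∂(hsLocalSpec σ ν Λ' ∅) =
      hsLocalSpec σ ν Λ' ∅ (A ∩ PointConfig.restrict (window Λ)ᶜ ⁻¹' E') := by
  have hW : MeasurableSet (window Λ) := measurableSet_window hΛ
  have hE : MeasurableSet (PointConfig.restrict (window Λ)ᶜ ⁻¹' E' : Set (PointConfig (EuclideanSpace ℝ ι × EuclideanSpace ℝ ι))) :=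
    hE'.preimage (PointConfig.measurable_restrict hW.compl)
  rw [← lintegral_hsLocalSpec_hsLocalSpec_empty ν h0 hΛ hΛ' hΛΛ' (hA.inter hE)]
  refine lintegral_congr fun ζ => ?_
  rw [hsLocalSpec_inter_preimage_restrict_compl ν σ hΛ ζ hA hE']

/-- **Covariance decay under the free finite-volume distribution**: for `P = γ_{B(0,R')}(· | ∅)`,
a local event `A = {ζ|_{B(0,k) × ℝ³} ∈ A'}`, an outside event `E = {ζ|_{(B(0,R) × ℝ³)ᶜ} ∈ E'}` and
`k + (d+2)σ ≤ R ≤ R'`,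
`|P(A ∩ E) - P(A) P(E)| ≤ 2 · (2 ν(B(0,k) × ℝ³) e^{ν(B(0,k) × ℝ³)} (2κ)^d) · P(E)`:
both `P` and `P(· | E)` are hard-core mixtures of the kernels `γ_{B(0,R)}(· | ζ)` (consistency, and
consistency with locality), hence both give `A` a probability within the boundary-influence bound
of the free value `γ_{B(0,R)}(∅)(A)`. [cite: MichelenPerkins2021, Thm 25 and §5] -/
theorem abs_measureReal_inter_sub_mul_le (hσ : 0 < σ) (h0 : ∀ x, ν {x} = 0)
    (hm : ∀ t : ℝ, ν {y : EuclideanSpace ℝ ι × EuclideanSpace ℝ ι | y.1 i₀ = t} = 0) {κ : ℝ} (hκ0 : 0 ≤ κ)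
    (hκ : ∀ a : (EuclideanSpace ℝ ι), ν (window (Metric.ball a σ)) ≤ ENNReal.ofReal κ)
    (hfin : ∀ R : ℝ, ν (window (Metric.ball (0 : (EuclideanSpace ℝ ι)) R)) ≠ ∞)
    {k R R' : ℝ} {d : ℕ} (hR : k + (d + 2) * σ ≤ R) (hRR' : R ≤ R')
    {A' E' : Set (PointConfig (EuclideanSpace ℝ ι × EuclideanSpace ℝ ι))} (hA' : MeasurableSet A') (hE' : MeasurableSet E') :
    |(hsLocalSpec σ ν (Metric.ball 0 R') ∅).real
        (PointConfig.restrict (window (Metric.ball (0 : (EuclideanSpace ℝ ι)) k)) ⁻¹' A' ∩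
          PointConfig.restrict (window (Metric.ball (0 : (EuclideanSpace ℝ ι)) R))ᶜ ⁻¹' E') -
      (hsLocalSpec σ ν (Metric.ball 0 R') ∅).real
          (PointConfig.restrict (window (Metric.ball (0 : (EuclideanSpace ℝ ι)) k)) ⁻¹' A') *
        (hsLocalSpec σ ν (Metric.ball 0 R') ∅).real
          (PointConfig.restrict (window (Metric.ball (0 : (EuclideanSpace ℝ ι)) R))ᶜ ⁻¹' E')| ≤
      2 * (2 * ν.real (window (Metric.ball (0 : (EuclideanSpace ℝ ι)) k)) *
        Real.exp (ν.real (window (Metric.ball (0 : (EuclideanSpace ℝ ι)) k))) * (2 * κ) ^ d) *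
        (hsLocalSpec σ ν (Metric.ball 0 R') ∅).real
          (PointConfig.restrict (window (Metric.ball (0 : (EuclideanSpace ℝ ι)) R))ᶜ ⁻¹' E') := by
  set P := hsLocalSpec σ ν (Metric.ball 0 R') ∅ with hP
  set A : Set (PointConfig (EuclideanSpace ℝ ι × EuclideanSpace ℝ ι)) := PointConfig.restrict (window (Metric.ball (0 : (EuclideanSpace ℝ ι)) k)) ⁻¹' A'
    with hA
  set E : Set (PointConfig (EuclideanSpace ℝ ι × EuclideanSpace ℝ ι)) :=
    PointConfig.restrict (window (Metric.ball (0 : (EuclideanSpace ℝ ι)) R))ᶜ ⁻¹' E' with hE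
  set δ : ℝ := 2 * ν.real (window (Metric.ball (0 : (EuclideanSpace ℝ ι)) k)) *
    Real.exp (ν.real (window (Metric.ball (0 : (EuclideanSpace ℝ ι)) k))) * (2 * κ) ^ d with hδ
  have hball : MeasurableSet (Metric.ball (0 : (EuclideanSpace ℝ ι)) R) := Metric.isOpen_ball.measurableSet
  have hball' : MeasurableSet (Metric.ball (0 : (EuclideanSpace ℝ ι)) R') := Metric.isOpen_ball.measurableSet
  have hAm : MeasurableSet A := hA'.preimage (PointConfig.measurable_restrict
    (measurableSet_window Metric.isOpen_ball.measurableSet))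
  have hEm : MeasurableSet E :=
    hE'.preimage (PointConfig.measurable_restrict (measurableSet_window hball).compl)
  haveI : IsProbabilityMeasure P :=
    isProbabilityMeasure_hsLocalSpec ν h0 hball' (hfin R') (isHardCore_restrict (isHardCore_empty σ) _)
  have hδ0 : 0 ≤ δ := by positivity
  -- `P` itself is a mixture (consistency)
  have hmixP : ∫⁻ η, hsLocalSpec σ ν (Metric.ball 0 R) η A ∂P = P A :=
    lintegral_hsLocalSpec_hsLocalSpec_empty ν h0 hball hball' (Metric.ball_subset_ball hRR') hAm
  have hPA := abs_measureReal_sub_hsLocalSpec_empty_le_of_mixture' i₀ ν hσ h0 hm hκ0 hκ hR (hfin R)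
    (hsLocalSpec_ae_isHardCore σ ν _ ∅) hA' hmixP
  by_cases hPE : P E = 0
  · have h1 : P.real (A ∩ E) = 0 := by
      rw [measureReal_def, measure_mono_null inter_subset_right hPE, ENNReal.toReal_zero]
    have h2 : P.real E = 0 := by rw [measureReal_def, hPE, ENNReal.toReal_zero]
    rw [h1, h2, mul_zero, mul_zero, sub_zero, abs_zero]
  -- the conditioned measure is a mixture too (consistency + locality)
  set ρ : Measure (PointConfig (EuclideanSpace ℝ ι × EuclideanSpace ℝ ι)) := (P E)⁻¹ • P.restrict E with hρ
  have hPEtop : P E ≠ ∞ := measure_ne_top P E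
  haveI : IsProbabilityMeasure ρ := ⟨by
    rw [hρ, Measure.smul_apply, smul_eq_mul, Measure.restrict_apply_univ,
      ENNReal.inv_mul_cancel hPE hPEtop]⟩
  have hρHC : ∀ᵐ η ∂ρ, IsHardCore σ η := by
    rw [hρ]
    exact Measure.ae_smul_measure (ae_restrict_of_ae (hsLocalSpec_ae_isHardCore σ ν _ ∅)) _
  have hρA : ρ A = (P E)⁻¹ * P (A ∩ E) := by
    rw [hρ, Measure.smul_apply, smul_eq_mul, Measure.restrict_apply hAm]
  have hmixρ : ∫⁻ η, hsLocalSpec σ ν (Metric.ball 0 R) η A ∂ρ = ρ A := by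
    rw [hρ, lintegral_smul_measure, hρA, ← lintegral_indicator hEm]
    congr 1
    rw [← lintegral_indicator_mul_hsLocalSpec_eq ν h0 hball hball' (Metric.ball_subset_ball hRR') hAm hE']
    refine lintegral_congr fun ζ => ?_
    by_cases hζ : ζ ∈ E
    · rw [indicator_of_mem hζ, indicator_of_mem hζ, Pi.one_apply, one_mul]
    · rw [indicator_of_notMem hζ, indicator_of_notMem hζ, zero_mul]
  have hρA' := abs_measureReal_sub_hsLocalSpec_empty_le_of_mixture' i₀ ν hσ h0 hm hκ0 hκ hR (hfin R)
    hρHC hA' hmixρ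
  -- combine
  have hdiff : |ρ.real A - P.real A| ≤ 2 * δ := by
    have := abs_sub_le (ρ.real A) ((hsLocalSpec σ ν (Metric.ball 0 R) ∅ A).toReal) (P.real A)
    rw [abs_sub_comm ((hsLocalSpec σ ν (Metric.ball 0 R) ∅ A).toReal)] at this
    linarith
  have hreal : P.real (A ∩ E) = ρ.real A * P.real E := by
    rw [measureReal_def, measureReal_def, measureReal_def, hρA, ENNReal.toReal_mul,
      ENNReal.toReal_inv, mul_comm ((P E).toReal⁻¹), mul_assoc,
      inv_mul_cancel₀ (ENNReal.toReal_ne_zero.2 ⟨hPE, hPEtop⟩), mul_one]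
  rw [hreal, ← sub_mul, abs_mul, abs_of_nonneg (measureReal_nonneg (μ := P) (s := E))]
  exact mul_le_mul_of_nonneg_right hdiff measureReal_nonneg

/-! ### The vacancy events of two distant balls -/

/-- The vacancy event of the ball window `B°_σ(0) × ℝ³` is a local event over `B(0, σ)`.
[folklore] -/
theorem setOf_count_window_ball_eq_zero_eq_preimage (σ : ℝ) :
    {c : PointConfig (EuclideanSpace ℝ ι × EuclideanSpace ℝ ι) | c.count (window (Metric.ball (0 : (EuclideanSpace ℝ ι)) σ)) = 0} =
      PointConfig.restrict (window (Metric.ball (0 : (EuclideanSpace ℝ ι)) σ)) ⁻¹'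
        {c : PointConfig (EuclideanSpace ℝ ι × EuclideanSpace ℝ ι) | c.count (window (Metric.ball (0 : (EuclideanSpace ℝ ι)) σ)) = 0} := by
  ext c
  simp only [mem_setOf_eq, mem_preimage, PointConfig.count_restrict, inter_self]

/-- The vacancy event of a ball window `B°_σ(x) × ℝ³` with `R + σ ≤ ‖x‖` is an event of the
configuration outside `B(0,R) × ℝ³`. [folklore] -/
theorem setOf_count_window_ball_eq_zero_eq_preimage_compl {σ R : ℝ} {x : (EuclideanSpace ℝ ι)} (hx : R + σ ≤ ‖x‖) :
    {c : PointConfig (EuclideanSpace ℝ ι × EuclideanSpace ℝ ι) | c.count (window (Metric.ball x σ)) = 0} =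
      PointConfig.restrict (window (Metric.ball (0 : (EuclideanSpace ℝ ι)) R))ᶜ ⁻¹'
        {c : PointConfig (EuclideanSpace ℝ ι × EuclideanSpace ℝ ι) | c.count (window (Metric.ball x σ)) = 0} := by
  have hsub : window (Metric.ball x σ) ⊆ (window (Metric.ball (0 : (EuclideanSpace ℝ ι)) R))ᶜ := by
    intro y hy
    simp only [mem_compl_iff, mem_window, Metric.mem_ball, dist_zero_right, not_lt] at hy ⊢
    have h1 : ‖x‖ ≤ ‖y.1‖ + dist y.1 x := by
      have := norm_le_norm_add_norm_sub' x y.1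
      rwa [← dist_eq_norm, dist_comm] at this
    linarith
  ext c
  simp only [mem_setOf_eq, mem_preimage, PointConfig.count_restrict,
    inter_eq_right.2 hsub]

/-- **Covariance decay for the vacancy events of two distant balls** under the free finite-volume
hard-sphere distribution `P = γ_{B(0,R')}(· | ∅)`: for `V = {N(B°_σ(0) × ℝ³) = 0}`,
`E_x = {N(B°_σ(x) × ℝ³) = 0}`, `(d+4)σ ≤ ‖x‖` and `‖x‖ - σ ≤ R'`,
`|P(V ∩ E_x) - P(V) P(E_x)| ≤ 2 · (2 ν(B°_σ(0) × ℝ³) e^{ν(B°_σ(0) × ℝ³)} (2κ)^d) · P(E_x)`.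
[cite: MichelenPerkins2021, Thm 25 and §5] -/
theorem abs_measureReal_vacant_inter_vacant_sub_le (hσ : 0 < σ) (h0 : ∀ x, ν {x} = 0)
    (hm : ∀ t : ℝ, ν {y : EuclideanSpace ℝ ι × EuclideanSpace ℝ ι | y.1 i₀ = t} = 0) {κ : ℝ} (hκ0 : 0 ≤ κ)
    (hκ : ∀ a : (EuclideanSpace ℝ ι), ν (window (Metric.ball a σ)) ≤ ENNReal.ofReal κ)
    (hfin : ∀ R : ℝ, ν (window (Metric.ball (0 : (EuclideanSpace ℝ ι)) R)) ≠ ∞)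
    {R' : ℝ} {x : (EuclideanSpace ℝ ι)} {d : ℕ} (hd : (d + 4) * σ ≤ ‖x‖) (hxR' : ‖x‖ - σ ≤ R') :
    |(hsLocalSpec σ ν (Metric.ball 0 R') ∅).real
        ({c : PointConfig (EuclideanSpace ℝ ι × EuclideanSpace ℝ ι) | c.count (window (Metric.ball (0 : (EuclideanSpace ℝ ι)) σ)) = 0} ∩
          {c : PointConfig (EuclideanSpace ℝ ι × EuclideanSpace ℝ ι) | c.count (window (Metric.ball x σ)) = 0}) -
      (hsLocalSpec σ ν (Metric.ball 0 R') ∅).real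
          {c : PointConfig (EuclideanSpace ℝ ι × EuclideanSpace ℝ ι) | c.count (window (Metric.ball (0 : (EuclideanSpace ℝ ι)) σ)) = 0} *
        (hsLocalSpec σ ν (Metric.ball 0 R') ∅).real
          {c : PointConfig (EuclideanSpace ℝ ι × EuclideanSpace ℝ ι) | c.count (window (Metric.ball x σ)) = 0}| ≤
      2 * (2 * ν.real (window (Metric.ball (0 : (EuclideanSpace ℝ ι)) σ)) *
        Real.exp (ν.real (window (Metric.ball (0 : (EuclideanSpace ℝ ι)) σ))) * (2 * κ) ^ d) *
        (hsLocalSpec σ ν (Metric.ball 0 R') ∅).real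
          {c : PointConfig (EuclideanSpace ℝ ι × EuclideanSpace ℝ ι) | c.count (window (Metric.ball x σ)) = 0} := by
  have hR : σ + (d + 2) * σ ≤ ‖x‖ - σ := by nlinarith
  have hx : (‖x‖ - σ) + σ ≤ ‖x‖ := by linarith
  have h := abs_measureReal_inter_sub_mul_le i₀ ν hσ h0 hm hκ0 hκ hfin hR hxR'
    (measurableSet_count_eq_zero (measurableSet_window_ball σ ((0 : (EuclideanSpace ℝ ι)), (0 : (EuclideanSpace ℝ ι)))))
    (measurableSet_count_eq_zero (measurableSet_window_ball σ (x, (0 : (EuclideanSpace ℝ ι)))))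
  rw [← setOf_count_window_ball_eq_zero_eq_preimage,
    ← setOf_count_window_ball_eq_zero_eq_preimage_compl hx] at h
  exact h

end Covariance

end HardSphereDLR

end Literature.MathematicalPhysics.KineticTheory
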